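import Summits.CriticalPhenomena.Ising3DConformalLimit.Theses.SynchronousCoupling
import Summits.CriticalPhenomena.Ising3DConformalLimit.Theorems.HyperoctahedralRPLimitRotationInvariant
import Summits.CriticalPhenomena.Ising3DConformalLimit.Theorems.HyperoctahedralRPHRP2Rigidity
import Summits.CriticalPhenomena.Ising3DConformalLimit.Theorems.HyperoctahedralRPExistsScaleCovariantLimitCruxIffOrbitPrecompactPointwiseLimit
import Summits.CriticalPhenomena.Ising3DConformalLimit.Theorems.HyperoctahedralRPExistsScaleCovariantLimitBlockLimitsGiveCrux
import Mathlib.Analysis.SpecialFunctions.Trigonometric.Bounds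
import Mathlib.Analysis.Complex.ExponentialBounds
import Mathlib.Analysis.Real.Pi.Bounds
import HarnessLib

/-!
# Disproof of `JoiningsTransfer` (crux stmt-CriticalPhenomena-18764, route `SynchronousCoupling`) — findings

Standing crux disprover `refuter-cdisprove-stmt-CriticalPhenomena-18764-0`, cycle 1 (2026-08-17).
STATUS at the end of cycle 1: the crux is CLOSED `proved` (2026-08-17T12:45Z, line `Sketch`,
`Cruxes.JoiningsTransfer.Sketch.JoiningsTransfer_proof`, Theorems/SynchronousCouplingJoiningsTransfer.lean) — it resisted
disproof because it is true. Landed negative/structural knowledge of this disprover (all ACCEPTED, `--supports` the item):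
`Theorems/JoiningsTransfer/Negative/TwoBaseCroftMutations.lean` (p158811: the three mutations of the skeleton are false),
`…/Negative/Irrefutable.lean` (p160699: `¬JT → ¬Ising3DConformalLimit`, `¬JT ↔ DJ ∧ RJ ∧ UR ∧ ¬PL`),
`…/Negative/TwoBaseCroftTight.lean` (p161047: the two-base Croft lemma itself holds — the analysis is exact).
`JoiningsTransfer := DilationJoinings → RotationJoining → UniformRegularity → (PL) ∧ (ROT)` with
(PL) = item 6153 `MirrorHoelderCompactness.PointwiseLimit` verbatim and (ROT) = the consequent of
`HyperoctahedralRP.LimitRotationInvariant`.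

## Verdict of cycle 1: NO KILL IS POSSIBLE at model level; the abstract skeleton's hypotheses are sharp

* §A ANATOMY. (ROT) is a theorem of the tree (`rot_holds` = `LimitRotationInvariant_of HRP2Rigidity_of`),
  so `jt_iff_core : JoiningsTransfer ↔ (DJ → RJ → UR → PL)`; `RotationJoining` is IDLE
  (`jt_of_pointwiseLimit`, `jt_of_blockLimits_of_dilationJoinings`). The whole content is
  `DilationJoinings → (UniformRegularity →) PointwiseLimit`, and by the landed block-limits funnel
  (`ExistsScaleCovariantLimit_of_blockLimits`, `pointwiseLimit_of_existsScaleCovariantLimit`) it is implied by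
  `DilationJoinings → BlockLimits` (convergence of the `V(L)`-normalised critical block moments along ALL `L`).
* §A IRREFUTABILITY. `Ising3DConformalLimit → PL → JoiningsTransfer` (`jt_of_summit`, re-pinning lemma
  `hasPointwiseScalingLimit_rhoPin`), hence `not_summit_of_not_jt : ¬JT → ¬Ising3DConformalLimit` and
  `not_jt_iff : ¬JT ↔ DJ ∧ RJ ∧ UR ∧ ¬PL`: refuting the crux means refuting the summit conjunct. No finite /
  certified-compute falsifier exists; no counterexample search was run (nothing to search).
* §B LOAD-BEARING AT MODEL LEVEL IS VACUOUS. Every dropped-hypothesis variant (`…WithoutDJ`, `…WithoutRJ`,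
  `…WithoutUR`, even all three dropped = PL ∧ ROT) follows from the summit (`without*_of_summit`), so NO
  `_false_without_<H>` theorem can be proved here short of `¬Ising3DConformalLimit`. Typing re-read (no junk):
  block normalisers `√V(b) ≥ 1`, integrands bounded and measurable, `π` a probability coupling, `C` may be any
  real, rotated cells of `RotationJoining` lie inside the window box (`√3·n(m+1) < 2n(m+1)`), (PL) at `n = 0, 1`
  harmless — agreeing with the birth vetting (item notes, refuter-rattack).
* §C THE ABSTRACT SKELETON AND ITS THREE MUTATIONS (the informative negative content; LANDED as
  `Theorems/JoiningsTransfer/Negative/TwoBaseCroftMutations.lean`, p158811). After `TowerCauchy`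
  (DJ + Hölder under the coupling + Newman/`stub_blockMomentBounded`: `|R_n(pL;k⃗) − R_n(L;k⃗)| ≤ C_n L^{-θ/2}`,
  `p = 2, 3`) the transfer is the TWO-BASE CROFT LEMMA `TwoBaseCroft` (card `towers-to-all-scales-croft`,
  verbatim; TRUE, prover's P1). Each of its hypotheses is necessary:
  - `not_twoBaseCroftWithoutThree`: base `3` dropped ⇒ false (`cos (2π log₂ L)`); so DJ's clause `p = 3` is
    load-bearing for this skeleton (and `p = 2` symmetrically);
  - `not_twoBaseCroftWithoutLogContinuity`: log-continuity dropped ⇒ false (indicator of `{2^i3^j}`, BOTH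
    towers exact): power-rate towers at every base point force nothing on a bare sequence;
  - `not_twoBaseCroftLittleO`: rate weakened to `o(1)` single steps (even for every base at once, with
    log-continuity) ⇒ false (`cos (π√(log₂ L))`): DJ's POWER RATE `θ > 0` (or at least summable / uniform
    tower control `sup_j |R(Lp^j) − R(L)| → 0`) is load-bearing — joinings "with o(1) defect but no power rate"
    (why-line of `DilationJoinings`) would not feed this transfer.
* §D HYPOTHESIS NOTES for the planner / lead (paper, not theorems):
  (i) the WINDOW-UNIFORMITY of `C` in `DilationJoinings` (`∃ C θ` before `∀ b m`) is NOT used by the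
  block-limits funnel — `BlockLimits` fixes `k⃗`, hence the window `m = max |kᵢ|`; the weaker
  `∀ m ∃ C θ ∀ b ∃ π …` suffices for (PL); (ii) `UniformRegularity` is very likely UNNECESSARY: the
  log-continuity of `L ↦ R_n(L;k⃗)` needed by `TwoBaseCroft` follows from Griffiths `G ≥ 0`, the PROVED
  Messager–Miracle-Solé coordinate monotonicity `messager_miracleSole_holds` (⇒ orthant-box doubling
  `Σ_{[0,2r+1]³} G ≤ 8 Σ_{[0,r]³} G` by `G(2w'+e) ≤ G(w')`, ⇒ box-susceptibility doubling with constant 64 by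
  reflection symmetry), `V(A) ≤ |A|·χ_box(diam A)`, `V(L) ≥ L³ χ_box(⌊(L−1)/2⌋)/8`, Cauchy–Schwarz for the
  cross term, and Newman's moment bounds — no two-point doubling item (6150) and no UR(b); (iii) RJ idle (§A).
* `-- Line Sketch` (picked 2026-08-17, 7 stubs): joint sufficiency is kernel-checked (`JoiningsTransfer_of`); stubs A–E2
  landed before this file's v2, E3 (`stub_logContinuity`: MomentDiff → BlockModel → SlabVariance → LogContinuity) vetted
  TRUE on paper (Y = X_{L'}(kᵢ), Z = X_L(kᵢ); `E(Y−Z)² ≤ 4·slab/V(L') + (√(V(L)/V(L')) − 1)²`, `1 ≤ V(L')/V(L) ≤ (1+√ε)²` by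
  `G ≥ 0` + Cauchy–Schwarz + SlabVariance at `k = 0`; `M` from `stub_blockMomentBounded` at the constant position vector) and
  then landed; no stub was breakable. `-- Targets`: none were ever stuck.

References: Kozma2007 §6.1 (arXiv:math/0508344 pp. 56–57: the ℤ³/2ℤ³/3ℤ³ coupling + density of `2^k3^{-n}`
+ continuity template); tree: `Theorems/ExistsScaleCovariantLimit/Negative/DyadicTwoPrimesDensity.lean`,
`…BlockLimitsGiveCrux.lean`, `…CruxIffOrbitPrecompactPointwiseLimit.lean`, `HyperoctahedralRP{LimitRotationInvariant,HRP2Rigidity}.lean`.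
-/

noncomputable section

namespace Summit.CriticalPhenomena.Ising3DConformalLimit.Cruxes.JoiningsTransfer.Disproof

open Literature.Probability.LatticeModels Filter Set
open scoped Topology
open Summit.CriticalPhenomena.Ising3DConformalLimit.Theses
open Summit.CriticalPhenomena.Ising3DConformalLimit.Theses.SynchronousCoupling
open Summit.CriticalPhenomena.Ising3DConformalLimit.MoebiusLimitExistsOnlyInteraction (rhoPin)

/-! ## §A Anatomy and irrefutability -/

/-- **(ROT) is a theorem of the tree** (items 1980 + 1979, proved): the second conjunct of the crux's
conclusion holds outright. [folklore] -/
theorem rot_holds : ∀ (ρ : ℝ → ℝ) (Δ : ℝ) (S : CorrFamily 3), (∀ δ ∈ Set.Ioc (0:ℝ) 1, 0 < ρ δ) →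
    HasPointwiseScalingLimit (criticalCorr 3) ρ S → (∀ n z, z ∉ NonCoincident 3 n → S n z = 0) →
    IsNondegenerateTwoPoint S → IsTranslationInvariant S → IsScaleCovariant Δ S → IsRotationInvariant S :=
  Cruxes.LimitRotationInvariant.QuarterTurnLiouville.LimitRotationInvariant_of
    Cruxes.HRP2Rigidity.XRayMellin.HRP2Rigidity_of

/-- The crux's `UniformRegularity` is item 4658 (`MirrorHoelderCompactness.UniformRegularity`) on the nose. -/
theorem ur_iff : SynchronousCoupling.UniformRegularity ↔ MirrorHoelderCompactness.UniformRegularity := Iff.rfl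

/-- **The core of the crux**: `JoiningsTransfer ↔ (DJ → RJ → UR → PointwiseLimit)`. [folklore] -/
theorem jt_iff_core : JoiningsTransfer ↔
    (DilationJoinings → RotationJoining → SynchronousCoupling.UniformRegularity →
      MirrorHoelderCompactness.PointwiseLimit) :=
  ⟨fun h hDJ hRJ hUR => (h hDJ hRJ hUR).1, fun h hDJ hRJ hUR => ⟨h hDJ hRJ hUR, rot_holds⟩⟩

/-- Item 6153 alone gives the crux (all three hypotheses idle GIVEN (PL)). [folklore] -/
theorem jt_of_pointwiseLimit (h : MirrorHoelderCompactness.PointwiseLimit) : JoiningsTransfer :=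
  jt_iff_core.2 fun _ _ _ => h

/-- Item 1981 (`ExistsScaleCovariantLimit`) gives the crux. [folklore] -/
theorem jt_of_existsScaleCovariantLimit (h : HyperoctahedralRP.ExistsScaleCovariantLimit) : JoiningsTransfer :=
  jt_of_pointwiseLimit (Cruxes.ExistsScaleCovariantLimit.TwoHierarchies.pointwiseLimit_of_existsScaleCovariantLimit h)

/-- **The block-limits funnel**: `(DJ → BlockLimits) → JoiningsTransfer`, by the LANDED
`ExistsScaleCovariantLimit_of_blockLimits` and `pointwiseLimit_of_existsScaleCovariantLimit`; neither
`RotationJoining` nor `UniformRegularity` is consumed. [folklore] -/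
theorem jt_of_blockLimits_of_dilationJoinings
    (h : DilationJoinings → Cruxes.ExistsScaleCovariantLimit.MonotoneBlockingPort.BlockLimits) : JoiningsTransfer :=
  jt_iff_core.2 fun hDJ _ _ => Cruxes.ExistsScaleCovariantLimit.TwoHierarchies.pointwiseLimit_of_existsScaleCovariantLimit
    (Cruxes.ExistsScaleCovariantLimit.MonotoneBlockingPort.ExistsScaleCovariantLimit_of_blockLimits (h hDJ))

/-- **summit ⟹ (PL)**: re-pin any witness of `Ising3DConformalLimit` by `hasPointwiseScalingLimit_rhoPin`;
`ρ★ = rhoPin` (`rhoStar_eq_rhoPin`). [folklore] -/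
theorem pointwiseLimit_of_summit (h : _root_.Ising3DConformalLimit) : MirrorHoelderCompactness.PointwiseLimit := by
  obtain ⟨ρ, Δ, S', hρ, -, hlim', hnd', -, -⟩ := h
  have hlim := ExistsScaleCovariantLimitNegative.Dyadic.hasPointwiseScalingLimit_rhoPin hρ hlim' hnd'
  intro n x hx
  rw [Cruxes.ExistsScaleCovariantLimit.TwoHierarchies.rhoStar_eq_rhoPin]
  exact ⟨_, (hlim n).tendsto_at hx⟩

/-- summit ⟹ crux. [folklore] -/
theorem jt_of_summit (h : _root_.Ising3DConformalLimit) : JoiningsTransfer :=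
  jt_of_pointwiseLimit (pointwiseLimit_of_summit h)

/-- **IRREFUTABILITY**: a refutation of the crux refutes the summit conjunct `Ising3DConformalLimit`.
[folklore] -/
theorem not_summit_of_not_jt (h : ¬ JoiningsTransfer) : ¬ _root_.Ising3DConformalLimit :=
  fun hs => h (jt_of_summit hs)

/-- What a refutation must produce: `¬JT ↔ DJ ∧ RJ ∧ UR ∧ ¬PL`. [folklore] -/
theorem not_jt_iff : ¬ JoiningsTransfer ↔
    (DilationJoinings ∧ RotationJoining ∧ SynchronousCoupling.UniformRegularity ∧
      ¬ MirrorHoelderCompactness.PointwiseLimit) := by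
  rw [jt_iff_core]
  constructor
  · intro h
    by_contra h'
    exact h fun hDJ hRJ hUR => Classical.by_contradiction fun hPL => h' ⟨hDJ, hRJ, hUR, hPL⟩
  · rintro ⟨hDJ, hRJ, hUR, hPL⟩ h
    exact hPL (h hDJ hRJ hUR)

/-! ## §B Load-bearing analysis at model level is vacuous

The dropped-hypothesis variants; each is implied by (PL), hence by the summit, so none can be refuted here. -/

/-- The crux with `DilationJoinings` dropped. -/
def JoiningsTransferWithoutDJ : Prop :=
  RotationJoining → SynchronousCoupling.UniformRegularity →
    MirrorHoelderCompactness.PointwiseLimit ∧ (∀ (ρ : ℝ → ℝ) (Δ : ℝ) (S : CorrFamily 3), (∀ δ ∈ Set.Ioc (0:ℝ) 1, 0 < ρ δ) →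
    HasPointwiseScalingLimit (criticalCorr 3) ρ S → (∀ n z, z ∉ NonCoincident 3 n → S n z = 0) →
    IsNondegenerateTwoPoint S → IsTranslationInvariant S → IsScaleCovariant Δ S → IsRotationInvariant S)

/-- The crux with `RotationJoining` dropped. -/
def JoiningsTransferWithoutRJ : Prop :=
  DilationJoinings → SynchronousCoupling.UniformRegularity →
    MirrorHoelderCompactness.PointwiseLimit ∧ (∀ (ρ : ℝ → ℝ) (Δ : ℝ) (S : CorrFamily 3), (∀ δ ∈ Set.Ioc (0:ℝ) 1, 0 < ρ δ) →
    HasPointwiseScalingLimit (criticalCorr 3) ρ S → (∀ n z, z ∉ NonCoincident 3 n → S n z = 0) →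
    IsNondegenerateTwoPoint S → IsTranslationInvariant S → IsScaleCovariant Δ S → IsRotationInvariant S)

/-- The crux with `UniformRegularity` dropped. -/
def JoiningsTransferWithoutUR : Prop :=
  DilationJoinings → RotationJoining →
    MirrorHoelderCompactness.PointwiseLimit ∧ (∀ (ρ : ℝ → ℝ) (Δ : ℝ) (S : CorrFamily 3), (∀ δ ∈ Set.Ioc (0:ℝ) 1, 0 < ρ δ) →
    HasPointwiseScalingLimit (criticalCorr 3) ρ S → (∀ n z, z ∉ NonCoincident 3 n → S n z = 0) →
    IsNondegenerateTwoPoint S → IsTranslationInvariant S → IsScaleCovariant Δ S → IsRotationInvariant S)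

/-- The crux with ALL hypotheses dropped: `(PL) ∧ (ROT)`. -/
def JoiningsTransferBare : Prop :=
    MirrorHoelderCompactness.PointwiseLimit ∧ (∀ (ρ : ℝ → ℝ) (Δ : ℝ) (S : CorrFamily 3), (∀ δ ∈ Set.Ioc (0:ℝ) 1, 0 < ρ δ) →
    HasPointwiseScalingLimit (criticalCorr 3) ρ S → (∀ n z, z ∉ NonCoincident 3 n → S n z = 0) →
    IsNondegenerateTwoPoint S → IsTranslationInvariant S → IsScaleCovariant Δ S → IsRotationInvariant S)

/-- `Bare ↔ PL` (ROT is a theorem). [folklore] -/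
theorem bare_iff_pointwiseLimit : JoiningsTransferBare ↔ MirrorHoelderCompactness.PointwiseLimit :=
  ⟨fun h => h.1, fun h => ⟨h, rot_holds⟩⟩

/-- Every variant sits between `Bare` and the crux. [folklore] -/
theorem variants_of_bare (h : JoiningsTransferBare) :
    JoiningsTransferWithoutDJ ∧ JoiningsTransferWithoutRJ ∧ JoiningsTransferWithoutUR ∧ JoiningsTransfer :=
  ⟨fun _ _ => h, fun _ _ => h, fun _ _ => h, fun _ _ _ => h⟩

/-- **No `_false_without_` theorem at model level**: the summit implies every dropped-hypothesis variant.
[folklore] -/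
theorem without_of_summit (hs : _root_.Ising3DConformalLimit) :
    JoiningsTransferWithoutDJ ∧ JoiningsTransferWithoutRJ ∧ JoiningsTransferWithoutUR ∧ JoiningsTransferBare :=
  have hb : JoiningsTransferBare := bare_iff_pointwiseLimit.2 (pointwiseLimit_of_summit hs)
  ⟨(variants_of_bare hb).1, (variants_of_bare hb).2.1, (variants_of_bare hb).2.2.1, hb⟩

/-- Contrapositive bookkeeping: refuting ANY variant refutes the summit. [folklore] -/
theorem not_summit_of_not_withoutUR (h : ¬ JoiningsTransferWithoutUR) : ¬ _root_.Ising3DConformalLimit :=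
  fun hs => h (without_of_summit hs).2.2.1

/-! ## §C The abstract skeleton (two-base Croft lemma) and its three mutations

LANDED copies (theorem-only, inline statements, namespace `…JoiningsTransferNegative`):
`Theorems/JoiningsTransfer/Negative/TwoBaseCroftMutations.lean` (p158811, the three `not_twoBaseCroft_*`) and
`Theorems/JoiningsTransfer/Negative/TwoBaseCroftTight.lean` (p161047, `twoBaseCroft`: the un-mutated lemma HOLDS, so the
three hypotheses are each necessary and jointly sufficient). Here the statements carry names. -/

/-- Log-scale asymptotic continuity of a real sequence (verbatim the second hypothesis of the card's
`TwoBaseCroft`, idea `towers-to-all-scales-croft`). -/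
def LogContinuous (R : ℕ → ℝ) : Prop :=
  ∀ ε : ℝ, 0 < ε → ∃ s : ℝ, 0 < s ∧ ∃ L₀ : ℕ, ∀ L L' : ℕ, L₀ ≤ L → L ≤ L' → (L':ℝ) ≤ (1+s)*L →
    |R L' - R L| ≤ ε

/-- Single-step tower bound with a power rate for the base `p`. -/
def TowerRate (p : ℕ) (R : ℕ → ℝ) : Prop :=
  ∃ C θ : ℝ, 0 < θ ∧ ∀ L : ℕ, 1 ≤ L → |R (p * L) - R L| ≤ C * (L:ℝ) ^ (-θ)

/-- The card's two-base Croft lemma (idea `towers-to-all-scales-croft`, `Sketch.TwoBaseCroft`), verbatim. -/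
def TwoBaseCroft : Prop := ∀ R : ℕ → ℝ, (∃ C θ : ℝ, 0 < θ ∧ ∀ L : ℕ, 1 ≤ L → |R (2*L) - R L| ≤ C * (L:ℝ)^(-θ) ∧ |R (3*L) - R L| ≤ C * (L:ℝ)^(-θ)) → (∀ ε : ℝ, 0 < ε → ∃ s : ℝ, 0 < s ∧ ∃ L₀ : ℕ, ∀ L L' : ℕ, L₀ ≤ L → L ≤ L' → (L':ℝ) ≤ (1+s)*L → |R L' - R L| ≤ ε) → ∃ M : ℝ, Filter.Tendsto R Filter.atTop (nhds M)

/-! ### Mutation 1: drop the base `3` -/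

/-- `TwoBaseCroft` with the `p = 3` tower dropped. -/
def TwoBaseCroftWithoutThree : Prop := ∀ R : ℕ → ℝ,
  (∃ C θ : ℝ, 0 < θ ∧ ∀ L : ℕ, 1 ≤ L → |R (2*L) - R L| ≤ C * (L:ℝ)^(-θ)) →
  LogContinuous R → ∃ M : ℝ, Tendsto R atTop (𝓝 M)

/-- The exactly `2`-self-similar, log-Lipschitz sequence `cos (2π log₂ L)`. -/
def cosLog (L : ℕ) : ℝ := Real.cos (2 * Real.pi * Real.logb 2 L)

theorem cosLog_two_mul {L : ℕ} (hL : 1 ≤ L) : cosLog (2 * L) = cosLog L := by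
  unfold cosLog
  have hL' : (0:ℝ) < L := by exact_mod_cast hL
  rw [Nat.cast_mul, Nat.cast_ofNat, Real.logb_mul two_ne_zero hL'.ne',
    Real.logb_self_eq_one one_lt_two, mul_add, mul_one, add_comm, Real.cos_add_two_pi]

theorem cosLog_two_pow (k : ℕ) : cosLog (2 ^ k) = 1 := by
  unfold cosLog
  rw [Nat.cast_pow, Nat.cast_ofNat, Real.logb_pow, Real.logb_self_eq_one one_lt_two, mul_one]
  have : 2 * Real.pi * (k:ℝ) = (k:ℝ) * (2 * Real.pi) := by ring
  rw [this, Real.cos_nat_mul_two_pi]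

theorem one_lt_logb_two_three : 1 < Real.logb 2 3 := by
  rw [Real.lt_logb_iff_rpow_lt one_lt_two (by norm_num)]
  norm_num

theorem logb_two_three_lt_two : Real.logb 2 3 < 2 := by
  rw [Real.logb_lt_iff_lt_rpow one_lt_two (by norm_num)]
  norm_num

theorem cosLog_three_mul_two_pow (k : ℕ) : cosLog (3 * 2 ^ k) = Real.cos (2 * Real.pi * Real.logb 2 3) := by
  unfold cosLog
  rw [Nat.cast_mul, Nat.cast_pow, Nat.cast_ofNat, Nat.cast_ofNat,
    Real.logb_mul (by norm_num) (by positivity), Real.logb_pow, Real.logb_self_eq_one one_lt_two,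
    mul_one, mul_add]
  have : 2 * Real.pi * (k:ℝ) = (k:ℤ) * (2 * Real.pi) := by push_cast; ring
  rw [this, Real.cos_add_int_mul_two_pi]

theorem cos_two_pi_logb_two_three_ne_one : Real.cos (2 * Real.pi * Real.logb 2 3) ≠ 1 := by
  rw [Ne, Real.cos_eq_one_iff]
  rintro ⟨n, hn⟩
  have h1 := one_lt_logb_two_three
  have h2 := logb_two_three_lt_two
  have hn' : (n:ℝ) = Real.logb 2 3 := by
    have hπ : (0:ℝ) < 2 * Real.pi := by positivity
    field_simp at hn
    linarith [hn]
  have h1' : (1:ℤ) < n := by exact_mod_cast (hn' ▸ h1 : (1:ℝ) < n)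
  have h2' : n < (2:ℤ) := by exact_mod_cast (hn' ▸ h2 : (n:ℝ) < 2)
  omega

theorem logContinuous_cosLog : LogContinuous cosLog := by
  intro ε hε
  refine ⟨ε / 20, by positivity, 1, fun L L' hL hLL' hL's => ?_⟩
  have hL0 : (0:ℝ) < L := by exact_mod_cast hL
  have hL'0 : (0:ℝ) < L' := by exact_mod_cast (le_trans hL hLL')
  unfold cosLog
  calc |Real.cos (2 * Real.pi * Real.logb 2 L') - Real.cos (2 * Real.pi * Real.logb 2 L)|
      ≤ |2 * Real.pi * Real.logb 2 L' - 2 * Real.pi * Real.logb 2 L| := Real.abs_cos_sub_cos_le _ _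
    _ = 2 * Real.pi * (Real.logb 2 L' - Real.logb 2 L) := by
        rw [← mul_sub, abs_of_nonneg]
        refine mul_nonneg (by positivity) (sub_nonneg.2 ?_)
        exact Real.logb_le_logb_of_le one_lt_two hL0 (by exact_mod_cast hLL')
    _ = 2 * Real.pi * Real.logb 2 ((L':ℝ) / L) := by
        rw [Real.logb_div hL'0.ne' hL0.ne']
    _ ≤ 2 * Real.pi * Real.logb 2 (1 + ε / 20) := by
        refine mul_le_mul_of_nonneg_left ?_ (by positivity)
        refine Real.logb_le_logb_of_le one_lt_two (by positivity) ?_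
        rw [div_le_iff₀ hL0]
        exact hL's
    _ = 2 * Real.pi * (Real.log (1 + ε / 20) / Real.log 2) := by rw [Real.logb]
    _ ≤ 2 * Real.pi * ((ε / 20) / Real.log 2) := by
        refine mul_le_mul_of_nonneg_left ?_ (by positivity)
        refine div_le_div_of_nonneg_right ?_ (Real.log_pos one_lt_two).le
        have := Real.log_le_sub_one_of_pos (show (0:ℝ) < 1 + ε / 20 by positivity)
        linarith
    _ ≤ ε := by
        have hlog2 : (0.6931471803:ℝ) < Real.log 2 := Real.log_two_gt_d9
        have hπ : Real.pi < 3.15 := Real.pi_lt_d2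
        rw [mul_div_assoc']
        rw [div_le_iff₀ (Real.log_pos one_lt_two)]
        nlinarith [Real.pi_pos]

theorem tendsto_two_pow_atTop : Tendsto (fun k : ℕ => 2 ^ k) atTop atTop :=
  tendsto_pow_atTop_atTop_of_one_lt one_lt_two

/-- **Mutation 1 is false**: the base `3` is load-bearing. [folklore] -/
theorem not_twoBaseCroftWithoutThree : ¬ TwoBaseCroftWithoutThree := by
  intro h
  obtain ⟨M, hM⟩ := h cosLog ⟨0, 1, one_pos, fun L hL => by
    rw [cosLog_two_mul hL, sub_self, abs_zero, zero_mul]⟩ logContinuous_cosLog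
  -- along `2^k` the value is `1`
  have h1 : Tendsto (fun k : ℕ => cosLog (2 ^ k)) atTop (𝓝 M) := hM.comp tendsto_two_pow_atTop
  simp_rw [cosLog_two_pow] at h1
  have hM1 : M = 1 := (tendsto_const_nhds_iff.1 h1).symm
  -- along `3·2^k` the value is the constant `cos (2π log₂ 3) ≠ 1`
  have h3 : Tendsto (fun k : ℕ => cosLog (3 * 2 ^ k)) atTop (𝓝 M) :=
    hM.comp ((tendsto_two_pow_atTop).const_mul_atTop' (by norm_num : 0 < 3))
  simp_rw [cosLog_three_mul_two_pow] at h3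
  have hM3 : M = Real.cos (2 * Real.pi * Real.logb 2 3) := (tendsto_const_nhds_iff.1 h3).symm
  exact cos_two_pi_logb_two_three_ne_one (hM3 ▸ hM1)

/-! ### Mutation 2: drop log-continuity -/

/-- `TwoBaseCroft` with the log-continuity hypothesis dropped (both power-rate towers kept). -/
def TwoBaseCroftWithoutLogContinuity : Prop := ∀ R : ℕ → ℝ,
  (∃ C θ : ℝ, 0 < θ ∧ ∀ L : ℕ, 1 ≤ L → |R (2*L) - R L| ≤ C * (L:ℝ)^(-θ) ∧ |R (3*L) - R L| ≤ C * (L:ℝ)^(-θ)) →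
  ∃ M : ℝ, Tendsto R atTop (𝓝 M)

/-- `L` is `3`-smooth: `L = 2^i 3^j`. -/
def IsSmooth23 (L : ℕ) : Prop := ∃ i j : ℕ, L = 2 ^ i * 3 ^ j

open Classical in
/-- The indicator of the `3`-smooth numbers: exactly invariant under `L ↦ 2L`, `L ↦ 3L`. -/
def smoothInd (L : ℕ) : ℝ := if IsSmooth23 L then 1 else 0

theorem isSmooth23_two_mul_iff (L : ℕ) : IsSmooth23 (2 * L) ↔ IsSmooth23 L := by
  constructor
  · rintro ⟨i, j, h⟩
    rcases Nat.eq_zero_or_pos i with rfl | hi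
    · exfalso
      have hodd : Odd (2 ^ 0 * 3 ^ j) := by simpa using Odd.pow (by decide : Odd 3)
      rw [← h] at hodd
      exact (Nat.not_even_iff_odd.2 hodd) (even_two_mul L)
    · refine ⟨i - 1, j, ?_⟩
      have : 2 ^ i = 2 * 2 ^ (i - 1) := by
        rw [← pow_succ']; congr 1; omega
      rw [this, mul_assoc] at h
      exact Nat.eq_of_mul_eq_mul_left two_pos h
  · rintro ⟨i, j, rfl⟩
    exact ⟨i + 1, j, by ring⟩

theorem isSmooth23_three_mul_iff (L : ℕ) : IsSmooth23 (3 * L) ↔ IsSmooth23 L := by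
  constructor
  · rintro ⟨i, j, h⟩
    rcases Nat.eq_zero_or_pos j with rfl | hj
    · exfalso
      have h3 : 3 ∣ 2 ^ i := ⟨L, by simpa [mul_comm] using h.symm⟩
      have := Nat.Prime.dvd_of_dvd_pow Nat.prime_three h3
      omega
    · refine ⟨i, j - 1, ?_⟩
      have : 3 ^ j = 3 * 3 ^ (j - 1) := by
        rw [← pow_succ']; congr 1; omega
      rw [this, mul_left_comm] at h
      exact Nat.eq_of_mul_eq_mul_left (by norm_num) h
  · rintro ⟨i, j, rfl⟩
    exact ⟨i, j + 1, by ring⟩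

theorem smoothInd_congr {L L' : ℕ} (h : IsSmooth23 L' ↔ IsSmooth23 L) : smoothInd L' = smoothInd L := by
  unfold smoothInd
  by_cases hL : IsSmooth23 L
  · rw [if_pos hL, if_pos (h.2 hL)]
  · rw [if_neg hL, if_neg (mt h.1 hL)]

theorem smoothInd_two_pow (k : ℕ) : smoothInd (2 ^ k) = 1 := by
  rw [smoothInd, if_pos]
  exact ⟨k, 0, by simp⟩

theorem not_isSmooth23_five_mul (k : ℕ) : ¬ IsSmooth23 (5 * 2 ^ k) := by
  rintro ⟨i, j, h⟩
  have h5 : 5 ∣ 2 ^ i * 3 ^ j := ⟨2 ^ k, by rw [← h]⟩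
  have hp : Nat.Prime 5 := Nat.prime_five
  rcases (Nat.Prime.dvd_mul hp).1 h5 with h2 | h3
  · have := Nat.Prime.dvd_of_dvd_pow hp h2; omega
  · have := Nat.Prime.dvd_of_dvd_pow hp h3; omega

theorem smoothInd_five_mul_two_pow (k : ℕ) : smoothInd (5 * 2 ^ k) = 0 := by
  rw [smoothInd, if_neg (not_isSmooth23_five_mul k)]

/-- **Mutation 2 is false**: log-continuity is load-bearing — the indicator of `{2^i 3^j}` has BOTH
towers exactly invariant (rate `0`) and does not converge. [folklore] -/
theorem not_twoBaseCroftWithoutLogContinuity : ¬ TwoBaseCroftWithoutLogContinuity := by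
  intro h
  obtain ⟨M, hM⟩ := h smoothInd ⟨0, 1, one_pos, fun L _ => by
    constructor
    · rw [smoothInd_congr (isSmooth23_two_mul_iff L), sub_self, abs_zero, zero_mul]
    · rw [smoothInd_congr (isSmooth23_three_mul_iff L), sub_self, abs_zero, zero_mul]⟩
  have h1 : Tendsto (fun k : ℕ => smoothInd (2 ^ k)) atTop (𝓝 M) := hM.comp tendsto_two_pow_atTop
  simp_rw [smoothInd_two_pow] at h1
  have h5 : Tendsto (fun k : ℕ => smoothInd (5 * 2 ^ k)) atTop (𝓝 M) :=
    hM.comp ((tendsto_two_pow_atTop).const_mul_atTop' (by norm_num : 0 < 5))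
  simp_rw [smoothInd_five_mul_two_pow] at h5
  have := (tendsto_const_nhds_iff.1 h1).trans (tendsto_const_nhds_iff.1 h5).symm
  norm_num at this

/-! ### Mutation 3: power rate weakened to `o(1)` single steps -/

/-- `TwoBaseCroft` with the power rate `C·L^{-θ}` of BOTH towers weakened to `o(1)`. -/
def TwoBaseCroftLittleO : Prop := ∀ R : ℕ → ℝ,
  Tendsto (fun L : ℕ => R (2 * L) - R L) atTop (𝓝 0) →
  Tendsto (fun L : ℕ => R (3 * L) - R L) atTop (𝓝 0) →
  LogContinuous R → ∃ M : ℝ, Tendsto R atTop (𝓝 M)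

/-- The slowly log-log-oscillating sequence `cos (π √(log₂ L))`. -/
def cosSqrtLog (L : ℕ) : ℝ := Real.cos (Real.pi * Real.sqrt (Real.logb 2 L))

theorem sqrt_sub_sqrt_le {t t' : ℝ} (ht : 1 ≤ t) (htt' : t ≤ t') :
    Real.sqrt t' - Real.sqrt t ≤ t' - t := by
  have hu : 1 ≤ Real.sqrt t := by simpa using Real.sqrt_le_sqrt ht
  have hv : Real.sqrt t ≤ Real.sqrt t' := Real.sqrt_le_sqrt htt'
  have ht0 : 0 ≤ t := by linarith
  have ht'0 : 0 ≤ t' := by linarith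
  nlinarith [Real.sq_sqrt ht0, Real.sq_sqrt ht'0]

theorem abs_cosSqrtLog_sub_le {L L' : ℕ} (hL : 2 ≤ L) (hLL' : L ≤ L') :
    |cosSqrtLog L' - cosSqrtLog L| ≤ Real.pi * (Real.logb 2 L' - Real.logb 2 L) := by
  have hL0 : (0:ℝ) < L := by exact_mod_cast (lt_of_lt_of_le two_pos hL)
  have ht : 1 ≤ Real.logb 2 (L:ℝ) := by
    rw [Real.le_logb_iff_rpow_le one_lt_two hL0, Real.rpow_one]; exact_mod_cast hL
  have htt' : Real.logb 2 (L:ℝ) ≤ Real.logb 2 (L':ℝ) :=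
    Real.logb_le_logb_of_le one_lt_two hL0 (by exact_mod_cast hLL')
  unfold cosSqrtLog
  calc |Real.cos (Real.pi * Real.sqrt (Real.logb 2 L')) - Real.cos (Real.pi * Real.sqrt (Real.logb 2 L))|
      ≤ |Real.pi * Real.sqrt (Real.logb 2 L') - Real.pi * Real.sqrt (Real.logb 2 L)| :=
        Real.abs_cos_sub_cos_le _ _
    _ = Real.pi * (Real.sqrt (Real.logb 2 L') - Real.sqrt (Real.logb 2 L)) := by
        rw [← mul_sub, abs_of_nonneg (mul_nonneg Real.pi_pos.le (sub_nonneg.2 (Real.sqrt_le_sqrt htt')))]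
    _ ≤ Real.pi * (Real.logb 2 L' - Real.logb 2 L) :=
        mul_le_mul_of_nonneg_left (sqrt_sub_sqrt_le ht htt') Real.pi_pos.le

theorem logContinuous_cosSqrtLog : LogContinuous cosSqrtLog := by
  intro ε hε
  refine ⟨ε / 10, by positivity, 2, fun L L' hL hLL' hL's => ?_⟩
  have hL0 : (0:ℝ) < L := by exact_mod_cast (lt_of_lt_of_le two_pos hL)
  have hL'0 : (0:ℝ) < L' := by exact_mod_cast (lt_of_lt_of_le (lt_of_lt_of_le two_pos hL) hLL')
  refine (abs_cosSqrtLog_sub_le hL hLL').trans ?_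
  calc Real.pi * (Real.logb 2 L' - Real.logb 2 L)
      = Real.pi * Real.logb 2 ((L':ℝ) / L) := by rw [Real.logb_div hL'0.ne' hL0.ne']
    _ ≤ Real.pi * Real.logb 2 (1 + ε / 10) := by
        refine mul_le_mul_of_nonneg_left ?_ Real.pi_pos.le
        refine Real.logb_le_logb_of_le one_lt_two (by positivity) ?_
        rw [div_le_iff₀ hL0]
        exact hL's
    _ = Real.pi * (Real.log (1 + ε / 10) / Real.log 2) := by rw [Real.logb]
    _ ≤ Real.pi * ((ε / 10) / Real.log 2) := by
        refine mul_le_mul_of_nonneg_left ?_ Real.pi_pos.le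
        refine div_le_div_of_nonneg_right ?_ (Real.log_pos one_lt_two).le
        have := Real.log_le_sub_one_of_pos (show (0:ℝ) < 1 + ε / 10 by positivity)
        linarith
    _ ≤ ε := by
        have hlog2 : (0.6931471803:ℝ) < Real.log 2 := Real.log_two_gt_d9
        have hπ : Real.pi < 3.15 := Real.pi_lt_d2
        rw [mul_div_assoc', div_le_iff₀ (Real.log_pos one_lt_two)]
        nlinarith [Real.pi_pos]

theorem tendsto_logb_two_nat : Tendsto (fun L : ℕ => Real.logb 2 (L:ℝ)) atTop atTop :=
  (Real.tendsto_logb_atTop one_lt_two).comp tendsto_natCast_atTop_atTop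

/-- single `p`-steps of `cosSqrtLog` are `o(1)` for EVERY `p ≥ 1`. -/
theorem tendsto_cosSqrtLog_step (p : ℕ) (hp : 1 ≤ p) :
    Tendsto (fun L : ℕ => cosSqrtLog (p * L) - cosSqrtLog L) atTop (𝓝 0) := by
  have hp0 : (0:ℝ) < p := by exact_mod_cast hp
  -- bound: for L ≥ 2, |step| ≤ π log₂ p / √(log₂ L)
  have hbound : ∀ᶠ L : ℕ in atTop, |cosSqrtLog (p * L) - cosSqrtLog L| ≤
      Real.pi * Real.logb 2 p * (Real.sqrt (Real.logb 2 L))⁻¹ := by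
    filter_upwards [eventually_ge_atTop 2] with L hL
    have hL0 : (0:ℝ) < L := by exact_mod_cast (lt_of_lt_of_le two_pos hL)
    have ht : 1 ≤ Real.logb 2 (L:ℝ) := by
      rw [Real.le_logb_iff_rpow_le one_lt_two hL0, Real.rpow_one]; exact_mod_cast hL
    have hLpL : L ≤ p * L := Nat.le_mul_of_pos_left L hp
    have htt' : Real.logb 2 (L:ℝ) ≤ Real.logb 2 ((p * L : ℕ):ℝ) :=
      Real.logb_le_logb_of_le one_lt_two hL0 (by exact_mod_cast hLpL)
    have ha : Real.logb 2 ((p * L : ℕ):ℝ) = Real.logb 2 p + Real.logb 2 L := by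
      rw [Nat.cast_mul, Real.logb_mul hp0.ne' hL0.ne']
    have hap : 0 ≤ Real.logb 2 (p:ℝ) := Real.logb_nonneg one_lt_two (by exact_mod_cast hp)
    unfold cosSqrtLog
    calc |Real.cos (Real.pi * Real.sqrt (Real.logb 2 ((p * L : ℕ):ℝ))) - Real.cos (Real.pi * Real.sqrt (Real.logb 2 L))|
        ≤ |Real.pi * Real.sqrt (Real.logb 2 ((p * L : ℕ):ℝ)) - Real.pi * Real.sqrt (Real.logb 2 L)| :=
          Real.abs_cos_sub_cos_le _ _
      _ = Real.pi * (Real.sqrt (Real.logb 2 ((p * L : ℕ):ℝ)) - Real.sqrt (Real.logb 2 L)) := by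
          rw [← mul_sub, abs_of_nonneg (mul_nonneg Real.pi_pos.le (sub_nonneg.2 (Real.sqrt_le_sqrt htt')))]
      _ ≤ Real.pi * (Real.logb 2 p * (Real.sqrt (Real.logb 2 L))⁻¹) := by
          refine mul_le_mul_of_nonneg_left ?_ Real.pi_pos.le
          set t := Real.logb 2 (L:ℝ) with ht_def
          set a := Real.logb 2 (p:ℝ) with ha_def
          rw [ha]
          have hst : 0 < Real.sqrt t := Real.sqrt_pos.2 (by linarith)
          rw [← div_eq_mul_inv, le_div_iff₀ hst]
          have h1 : 0 ≤ t := by linarith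
          have h2 : 0 ≤ a + t := by linarith
          nlinarith [Real.sq_sqrt h1, Real.sq_sqrt h2, Real.sqrt_nonneg (a + t), Real.sqrt_le_sqrt (le_add_of_nonneg_left hap : t ≤ a + t)]
      _ = Real.pi * Real.logb 2 p * (Real.sqrt (Real.logb 2 L))⁻¹ := by ring
  have hsqrt : Tendsto Real.sqrt atTop atTop := by
    refine Filter.tendsto_atTop_atTop.2 fun b => ⟨b ^ 2, fun x hx => ?_⟩
    calc b ≤ |b| := le_abs_self b
      _ = Real.sqrt (b ^ 2) := (Real.sqrt_sq_eq_abs b).symm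
      _ ≤ Real.sqrt x := Real.sqrt_le_sqrt hx
  have hlim : Tendsto (fun L : ℕ => Real.pi * Real.logb 2 p * (Real.sqrt (Real.logb 2 L))⁻¹) atTop (𝓝 0) := by
    have := ((hsqrt.comp tendsto_logb_two_nat).inv_tendsto_atTop).const_mul (Real.pi * Real.logb 2 p)
    simpa using this
  exact squeeze_zero_norm' hbound hlim

theorem cosSqrtLog_two_pow_sq (n : ℕ) : cosSqrtLog (2 ^ (n ^ 2)) = Real.cos (Real.pi * n) := by
  unfold cosSqrtLog
  rw [Nat.cast_pow, Nat.cast_ofNat, Real.logb_pow, Real.logb_self_eq_one one_lt_two, mul_one,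
    Nat.cast_pow, Real.sqrt_sq (Nat.cast_nonneg n)]

theorem tendsto_two_pow_sq_even : Tendsto (fun k : ℕ => 2 ^ ((2 * k) ^ 2)) atTop atTop := by
  refine tendsto_atTop_mono (fun k => ?_) tendsto_id
  calc id k = k := rfl
    _ ≤ (2 * k) ^ 2 := by nlinarith
    _ ≤ 2 ^ ((2 * k) ^ 2) := Nat.lt_two_pow_self.le

theorem tendsto_two_pow_sq_odd : Tendsto (fun k : ℕ => 2 ^ ((2 * k + 1) ^ 2)) atTop atTop := by
  refine tendsto_atTop_mono (fun k => ?_) tendsto_id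
  calc id k = k := rfl
    _ ≤ (2 * k + 1) ^ 2 := by nlinarith
    _ ≤ 2 ^ ((2 * k + 1) ^ 2) := Nat.lt_two_pow_self.le

/-- **Mutation 3 is false**: the power rate is load-bearing — with `o(1)` single steps (even for every
base `p` at once) and log-continuity, `cos (π √(log₂ L))` does not converge. [folklore] -/
theorem not_twoBaseCroftLittleO : ¬ TwoBaseCroftLittleO := by
  intro h
  obtain ⟨M, hM⟩ := h cosSqrtLog (tendsto_cosSqrtLog_step 2 (by norm_num))
    (tendsto_cosSqrtLog_step 3 (by norm_num)) logContinuous_cosSqrtLog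
  have he : Tendsto (fun k : ℕ => cosSqrtLog (2 ^ ((2 * k) ^ 2))) atTop (𝓝 M) := hM.comp tendsto_two_pow_sq_even
  have ho : Tendsto (fun k : ℕ => cosSqrtLog (2 ^ ((2 * k + 1) ^ 2))) atTop (𝓝 M) := hM.comp tendsto_two_pow_sq_odd
  simp_rw [cosSqrtLog_two_pow_sq] at he ho
  have he' : ∀ k : ℕ, Real.cos (Real.pi * ((2 * k : ℕ) : ℝ)) = 1 := fun k => by
    rw [show Real.pi * ((2 * k : ℕ) : ℝ) = (k:ℝ) * (2 * Real.pi) by push_cast; ring]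
    exact Real.cos_nat_mul_two_pi k
  have ho' : ∀ k : ℕ, Real.cos (Real.pi * ((2 * k + 1 : ℕ) : ℝ)) = -1 := fun k => by
    rw [show Real.pi * ((2 * k + 1 : ℕ) : ℝ) = (k:ℝ) * (2 * Real.pi) + Real.pi by push_cast; ring]
    exact Real.cos_nat_mul_two_pi_add_pi k
  simp_rw [he'] at he
  simp_rw [ho'] at ho
  have := (tendsto_const_nhds_iff.1 he).trans (tendsto_const_nhds_iff.1 ho).symm
  norm_num at this


/-! ## §D Hypothesis notes (see the module docstring): window-uniformity of `C` unused by the funnel;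
`UniformRegularity` likely unnecessary (log-continuity of block moments from Griffiths + MMS + Newman);
`RotationJoining` idle; `θ > 0` and the base `3` load-bearing for the skeleton (§C). -/

/-! ## -- Line Sketch / -- Targets
Line `Sketch` (card towers-to-all-scales-croft) picked and CLOSED within cycle 1: stubs A `stub_twoBaseCroft`,
B `stub_momentDiff`, C `stub_blockModel`, D `stub_towerCauchy`, E1 `stub_ballSumRatio`, E2 `stub_slabVariance`,
E3 `stub_logContinuity` all landed; `JoiningsTransfer_proof` closes the item (proved). No stub was ever stuck; the
disprover's stub-level finding is §C (A's hypotheses — D's power rate and E3's log-continuity — are load-bearing). -/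

end Summit.CriticalPhenomena.Ising3DConformalLimit.Cruxes.JoiningsTransfer.Disproof

end
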